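import Literature.NumberTheory.EllipticCurves.AnticyclotomicBigGaloisRep
import HarnessLib

/-!
# K2 crux 19270 `IMCDivAtErratumDataAll` (H3♭), ROAD FF — the D1-side hypotheses of the landed glue
# `XAc.map_charIdeal_le_span_of_roadFF_unr_le` (p477148) DISCHARGED for every big representation
# `bigRep κ ρ` (lit g14's object `Literature/…/AnticyclotomicBigGaloisRep.lean`): `p`-divisibility,
# the INVARIANTS CRITERION (`H⁰(G, T ⊗ Λ^*(Ψ⁻¹)) = 0 ⟸ A^G[p^∞] = 0`, no Shapiro), the inertia form

Cell `bsd-stepL`, seat `bsd-stepL-imc-p1` (g8). `--supports stmt-BirchSwinnertonDyer-19270 --as helper`.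
HONEST FRAMING: BSD is not proved for any pair by this file; it closes no item; no definition, no
named fact, no `sorry`. Sequel of the g7 series p470728 ∕ p474991 ∕ p475740 ∕ p476122 ∕ p476656 ∕
p477148 (the object-abstract Road-FF glue), written the day the OBJECT `bigRep κ ρ` landed
(p476635 + Part 5 p478852).

## What the glue asks of the objects, and what this file proves

The end form `XAc.map_charIdeal_le_span_of_roadFF_unr_le` takes, for `M_f = ρf` and every member
`M_{g_m} = ρg m` (`ContinuousRep Γ₀ Λ ·` on discrete `Λ = ℤ_p⟦T⟧`-modules), three "Lemma 2.1"
hypotheses in DIVISIBLE-invariants shape (p476122 §1):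

* `hdiv`  — `M` is `p`-divisible (`Λ^*` is divisible);
* `hglob` — the global invariants `M^{Γ₀}` are `p^m`-divisible ("`H⁰(K, M_g) = H⁰(K_∞, A_g) = 0` by
  Shapiro's lemma and the irreducibility of `ρ̄_g|_{G_K}`", erratum Lemma 2.1, p. 2);
* `hloc`  — at every constrained index `v ∈ L₀`, the invariants of `M` restricted along
  `ψ_v : Γ_v → Γ₀` are `p^m`-divisible ("the kernel of the second arrow is given by
  `H⁰(K_𝔭, M_g)/ϖ^m H⁰(K_𝔭, M_g)` and this vanishes when so does `H⁰(K_𝔭, A_g[ϖ])`", ibid.).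

For `M = bigRep κ ρ` — smooth `p`-primary functions `Φ : ℤ_p → A`, `(g·Φ)(x) = ρ(g)(Φ(x − κ g))`,
`(T·Φ)(x) = Φ(x+1) − Φ(x)` — these become STATEMENTS ABOUT `A` (`= E[p^∞] ⊗ 𝒪`, `A_{g_m}`):

* §1 **`natCast_smul_surjective`** ∕ **`C_smul_surjective`** ∕ **`C_pow_smul_surjective`**: if
  every `p`-power-torsion element of `A` is a `p`-th multiple, `Φ ↦ p·Φ` (`= C(p)·Φ`) is onto `M`
  (pointwise section through the values; the section of a `p^k`-torsion value is `p^{k+1}`-torsion,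
  levels are preserved) — `hdiv`.
* §2 **`eq_zero_of_forall_bigRep_apply_eq`** ∕ **`bigRep_invariants_eq_bot`** — THE INVARIANTS
  CRITERION: if `A` has no nonzero `G`-fixed `p`-power-torsion element then `M^G = 0`. Proof (no
  Shapiro, no socle bookkeeping): `M^G` is a `Λ`-submodule (the `G`-action is `Λ`-linear) on which
  `T = τ₁ − 1` is locally nilpotent (`BigRepModule.shiftSubOne_locNil`), so by induction on the
  nilpotence exponent a nonzero invariant yields a nonzero invariant KILLED BY `T`, i.e. with
  `Φ(x+1) = Φ(x)`; a smooth function with that property is CONSTANT (`ℕ` is dense in `ℤ_p`: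
  `PadicInt.appr_spec`), `Φ ≡ a`, and invariance of the constant reads `ρ(g) a = a` for all `g`; `a`
  is `p`-power torsion (`exists_torsion`), hence `a = 0`. With `G = Γ_K` this is
  "`H⁰(K, M_f) = 0` ⟸ `E(K)[p] = 0`" and, after `bigRep_restrict`, with `G = Γ_{K_𝔭}` it is
  "`H⁰(K_𝔭, M_f) = 0` ⟸ `E(K_𝔭)[p] = E(ℚ_p)[p] = 0`" = hypothesis (iv) — `hglob` and `hloc` at the
  decomposition index. (Consistency with Shapiro: `M^{Γ_K} = E(K_∞)[p^∞]`, which vanishes iff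
  `E(K)[p]` does, `Gal(K_∞/K)` being pro-`p`; the local nilpotence of `T` IS that pro-`p`-ness.)
* §3 **`bigRep_restrict_apply_eq_self`** ∕ **`bigRep_restrict_invariants_eq_top`**: along
  `φ : H → G` with `κ ∘ φ = 1` and `ρ ∘ φ` trivial (an INERTIA group at a place `w ∤ p` where `T`
  is unramified: every `ℤ_p`-extension is unramified outside `p`), `M|_H` is the trivial
  representation, so its invariants are all of `M` and are `p^m`-divisible by §1 — `hloc` at the
  inertia indices of the erratum's `ker{H¹(G_{K,S}, M) → H¹(K_𝔭, M)}`, `S = Σ ∪ S_p` (defn-ty1's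
  `strictSet`, p478886: decomposition at `𝔮`, inertia at `w ∉ Σ`, `w ∤ p`).
* §4 PACKAGING in the glue's literal hypothesis shapes: **`divisibleInvariants_bigRep`** (`hglob`),
  **`divisibleInvariants_bigRep_restrict_of_forall_fixed_eq_zero`** (decomposition-type `hloc`),
  **`divisibleInvariants_bigRep_restrict_of_trivial`** (inertia-type `hloc`), and the family form
  **`divisibleInvariants_bigRep_restrict_of_cases`** over ANY `(ψ_v)_{v}`, `L₀` whose constrained
  indices are of one of the two types — ready to be instantiated at `(localMap K, strictSet p 𝔮 Σ)`.

Everything is stated for a general coefficient ring `𝒪` (scalar `C (p : 𝒪)`), any topological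
group `G`, any discrete `𝒪`-module `A`; pure algebra on the constructed module; CONDITIONAL on
nothing; closes nothing.

References: [Castella2018Erratum] Lemma 2.1 and its proof (p. 2); [Castella2018] §2.1 (`𝒜 = T ⊗ Λ^*`,
action `ρ ⊗ Ψ⁻¹`), §2.2 (`1 + T ↦ γ`); [Skinner2016PacificMC] §2.3, Lemma 2.3.1 (p. 180: "`(𝓜⁻)^{I_p} ≅
Hom_cts(𝒪, ℚ_p/ℤ_p)` … is `p`-divisible"); [SkinnerUrban2014] Prop. 3.2.3 (Shapiro, for comparison
only); [GreenbergLNM1716] §1 (discrete `Λ`-modules, `T` locally nilpotent).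
-/

noncomputable section

open PowerSeries Literature.NumberTheory.GaloisRepresentations Literature.NumberTheory.EllipticCurves
  Literature.NumberTheory.EllipticCurves.BigRepModule

namespace Summit.BirchSwinnertonDyer.Rank1Residual.X11b.BigRep

variable {𝒪 : Type*} [CommRing 𝒪] {p : ℕ} [Fact p.Prime] {A : Type*} [AddCommGroup A] [Module 𝒪 A]

/-! ### §1 Divisibility of `M = T ⊗ Λ^*` by `p` (`hdiv`) -/

section Divisible

/-- **`hdiv`: `Φ ↦ p • Φ` is onto the big module** when every `p`-power-torsion element of `A` is a
`p`-th multiple in `A` (e.g. `A = E[p^∞] ⊗ 𝒪`, `A_g = V_g/T_g`: divisible groups). A section is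
taken pointwise through the finitely many values; a `p`-th root of a `p^k`-torsion value is
`p^{k+1}`-torsion and the level is preserved. ("`Λ_𝒪^*` … is `p`-divisible", [Ski16, p. 180].)
[cite: Skinner2016PacificMC, §2.3, proof of Lemma 2.3.1 (p. 180)] -/
theorem natCast_smul_surjective
    (hA : ∀ a : A, (∃ k : ℕ, p ^ k • a = 0) → ∃ b : A, p • b = a) :
    Function.Surjective fun Φ : BigRepModule 𝒪 p A => (p : 𝒪) • Φ := by
  classical
  -- a pointwise section `sec` of multiplication by `p` on the `p`-power torsion of `A`
  set sec : A → A := fun a => if h : ∃ k : ℕ, p ^ k • a = 0 then Classical.choose (hA a h) else 0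
    with hsec_def
  have hsec : ∀ a : A, (∃ k : ℕ, p ^ k • a = 0) → p • sec a = a := fun a h => by
    rw [hsec_def]
    simp only [dif_pos h]
    exact Classical.choose_spec (hA a h)
  intro Φ
  obtain ⟨n, hn⟩ := Φ.exists_level
  obtain ⟨k, hk⟩ := Φ.exists_torsion
  have htor : ∀ x, ∃ k : ℕ, p ^ k • Φ x = 0 := fun x => ⟨k, hk x⟩
  refine ⟨BigRepModule.mk (fun x => sec (Φ x)) ⟨⟨n, fun x y hxy => congrArg sec (hn x y hxy)⟩,
    ⟨k + 1, fun x => ?_⟩⟩, ?_⟩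
  · rw [pow_succ, mul_smul, hsec (Φ x) (htor x), hk x]
  · ext x
    change ((p : 𝒪) • BigRepModule.mk (fun x => sec (Φ x)) _) x = Φ x
    rw [BigRepModule.smul_apply, BigRepModule.mk_apply, Nat.cast_smul_eq_nsmul, hsec (Φ x) (htor x)]

/-- `hdiv` in the glue's scalar: `Φ ↦ C(p) • Φ` is onto (`C c` acts as `c`, `BigRepModule.C_smul`).
[cite: Skinner2016PacificMC, §2.3, proof of Lemma 2.3.1 (p. 180)] -/
theorem C_smul_surjective
    (hA : ∀ a : A, (∃ k : ℕ, p ^ k • a = 0) → ∃ b : A, p • b = a) :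
    Function.Surjective fun Φ : BigRepModule 𝒪 p A => (C (p : 𝒪) : PowerSeries 𝒪) • Φ := by
  intro Φ
  obtain ⟨Ψ, hΨ⟩ := natCast_smul_surjective (𝒪 := 𝒪) hA Φ
  refine ⟨Ψ, ?_⟩
  change (C (p : 𝒪) : PowerSeries 𝒪) • Ψ = Φ
  rw [C_smul]
  exact hΨ

/-- Powers: `Φ ↦ C(p)^m • Φ` is onto (`p^m`-divisibility of `M`). [cite: Skinner2016PacificMC, §2.3, proof of Lemma 2.3.1 (p. 180)] -/
theorem C_pow_smul_surjective
    (hA : ∀ a : A, (∃ k : ℕ, p ^ k • a = 0) → ∃ b : A, p • b = a) (m : ℕ) :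
    Function.Surjective fun Φ : BigRepModule 𝒪 p A => (C (p : 𝒪) : PowerSeries 𝒪) ^ m • Φ := by
  induction m with
  | zero => intro Φ; exact ⟨Φ, by simp⟩
  | succ m ih =>
    intro Φ
    obtain ⟨Ψ, rfl⟩ := C_smul_surjective (𝒪 := 𝒪) hA Φ
    obtain ⟨Θ, rfl⟩ := ih Ψ
    exact ⟨Θ, by simp only [pow_succ', mul_smul]⟩

end Divisible

/-! ### §2 The invariants criterion: `(T ⊗ Λ^*(Ψ⁻¹))^G = 0 ⟸ A^G[p^∞] = 0` -/

section Invariants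

variable [TopologicalSpace 𝒪] [TopologicalSpace A] {G : Type*} [Group G] [TopologicalSpace G]

omit [TopologicalSpace 𝒪] [TopologicalSpace A] in
/-- A smooth function killed by `T = τ₁ − 1` (i.e. `Φ(x + 1) = Φ(x)` for all `x`) is CONSTANT: it is
constant on the cosets of some `pⁿℤ_p`, each of which contains a natural number
(`PadicInt.appr_spec`), and `Φ(m) = Φ(0)` for `m ∈ ℕ` by induction. [cite: GreenbergLNM1716, §1 (discrete Λ-modules: the T-torsion)] -/
theorem apply_eq_apply_zero_of_shiftSubOne_eq_zero (Φ : BigRepModule 𝒪 p A)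
    (hΦ : shiftSubOne Φ = 0) (x : ℤ_[p]) : Φ x = Φ 0 := by
  have hstep : ∀ y : ℤ_[p], Φ (y + 1) = Φ y := fun y => by
    have h := DFunLike.congr_fun hΦ y
    rw [shiftSubOne_apply, BigRepModule.zero_apply, sub_eq_zero] at h
    exact h
  have hnat : ∀ m : ℕ, Φ (m : ℤ_[p]) = Φ 0 := fun m => by
    induction m with
    | zero => rw [Nat.cast_zero]
    | succ m ih => rw [Nat.cast_succ, hstep, ih]
  obtain ⟨n, hn⟩ := Φ.exists_level
  rw [hn x ((x.appr n : ℕ) : ℤ_[p]) (PadicInt.appr_spec n x), hnat]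

variable [DiscreteTopology A] [ContinuousMul G] [TopologicalSpace (PowerSeries 𝒪)]

/-- The `G`-action on the big module commutes with `T = τ₁ − 1` (it is `Λ`-linear). [cite: Castella2018, §2.1 (the G_K-action on the Λ-module 𝒜)] -/
theorem bigRep_apply_shiftSubOne (κ : G →ₜ* Multiplicative ℤ_[p]) (ρ : ContinuousRep G 𝒪 A)
    (g : G) (Φ : BigRepModule 𝒪 p A) :
    bigRep κ ρ g (shiftSubOne Φ) = shiftSubOne (bigRep κ ρ g Φ) := by
  rw [← X_smul, ← X_smul, map_smul]

/-- **THE INVARIANTS CRITERION (pointwise form).** If `A` has no nonzero `G`-fixed `p`-power-torsion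
element, the big representation `M = T ⊗ Λ^*(Ψ⁻¹)` has no nonzero `G`-invariant: an invariant killed
by `Tᴺ` is zero, by induction on `N` — for `N + 1`, `T·Φ` is invariant (the action is `Λ`-linear)
and killed by `Tᴺ`, hence zero, so `Φ` is constant `≡ a` with `ρ(g) a = a` for all `g` (read the
invariance at `x = κ g`) and `a` `p`-power torsion, hence `a = 0`; and every `Φ` is killed by some
`Tᴺ` (`shiftSubOne_locNil`). For `G = Γ_K`, `A = E[p^∞]`: "`H⁰(K, M) = 0`" from `E(K)[p] = 0`
(⟸ irreducibility of `E[p]|_{G_K}`); for `G = Γ_{K_𝔭}`: from `E(K_𝔭)[p] = 0` = (iv). No Shapiro.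
[cite: Castella2018Erratum, Lemma 2.1, proof (p. 2: "H⁰(K, M_g) = H⁰(K_∞, A_g) = 0 … irreducibility"; "vanishes when so does H⁰(K_𝔭, A_g[ϖ])")] -/
theorem eq_zero_of_forall_bigRep_apply_eq (κ : G →ₜ* Multiplicative ℤ_[p]) (ρ : ContinuousRep G 𝒪 A)
    (hA : ∀ a : A, (∀ g : G, ρ g a = a) → (∃ k : ℕ, p ^ k • a = 0) → a = 0)
    (Φ : BigRepModule 𝒪 p A) (hΦ : ∀ g : G, bigRep κ ρ g Φ = Φ) : Φ = 0 := by
  -- strengthen to: every invariant killed by `(τ₁ - 1)^N` vanishes, by induction on `N`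
  suffices key : ∀ (N : ℕ) (Ψ : BigRepModule 𝒪 p A), (∀ g : G, bigRep κ ρ g Ψ = Ψ) →
      (shiftSubOne ^ N) Ψ = 0 → Ψ = 0 by
    obtain ⟨N, hN⟩ := shiftSubOne_locNil (𝒪 := 𝒪) (p := p) (A := A) Φ
    exact key N Φ hΦ hN
  intro N
  induction N with
  | zero =>
    intro Ψ _ hN
    rwa [pow_zero, Module.End.one_apply] at hN
  | succ N ih =>
    intro Ψ hΨ hN
    -- `T • Ψ` is invariant and killed by `T^N`, hence zero
    have hT : shiftSubOne Ψ = 0 := by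
      refine ih (shiftSubOne Ψ) (fun g => ?_) ?_
      · rw [bigRep_apply_shiftSubOne, hΨ g]
      · rw [← Module.End.mul_apply, ← pow_succ, hN]
    -- so `Ψ` is constant, `Ψ ≡ a`
    have hconst := apply_eq_apply_zero_of_shiftSubOne_eq_zero Ψ hT
    -- `a` is `G`-fixed and `p`-power torsion, hence zero
    have ha : Ψ 0 = 0 := by
      refine hA (Ψ 0) (fun g => ?_) ?_
      · have h := DFunLike.congr_fun (hΨ g) 0
        rw [bigRep_apply_apply, hconst] at h
        exact h
      · obtain ⟨k, hk⟩ := Ψ.exists_torsion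
        exact ⟨k, hk 0⟩
    ext x
    rw [hconst x, ha, BigRepModule.zero_apply]

variable [ContinuousSMul (PowerSeries 𝒪) (BigRepModule 𝒪 p A)]

/-- **THE INVARIANTS CRITERION**: `M^G = ⊥` for `M = bigRep κ ρ` (invariants of the attached
topological representation, the object of the glue's `hglob`/`hloc`) if `A` has no nonzero
`G`-fixed `p`-power-torsion element. [cite: Castella2018Erratum, Lemma 2.1, proof (p. 2)] -/
theorem bigRep_invariants_eq_bot (κ : G →ₜ* Multiplicative ℤ_[p]) (ρ : ContinuousRep G 𝒪 A)
    (hA : ∀ a : A, (∀ g : G, ρ g a = a) → (∃ k : ℕ, p ^ k • a = 0) → a = 0) :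
    (bigRep (p := p) κ ρ).toTopRep.ρ.invariants = ⊥ :=
  (Submodule.eq_bot_iff _).2 fun Φ hΦ =>
    eq_zero_of_forall_bigRep_apply_eq κ ρ hA Φ fun g => hΦ g

/-- Converse bookkeeping (for the record): a `G`-fixed `p`-power-torsion `a ∈ A` gives the
CONSTANT invariant `Φ ≡ a` — so the criterion is sharp (`M^G = 0 ↔ A^G[p^∞] = 0`).
[cite: Castella2018, §2.1 (the G_K-action ρ ⊗ Ψ^{-1} on 𝒜 = T ⊗ Λ^*)] -/
theorem const_mem_bigRep_invariants (κ : G →ₜ* Multiplicative ℤ_[p]) (ρ : ContinuousRep G 𝒪 A)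
    {a : A} (ha : ∀ g : G, ρ g a = a) {k : ℕ} (hk : p ^ k • a = 0) :
    BigRepModule.mk (fun _ : ℤ_[p] => a) ⟨⟨0, fun _ _ _ => rfl⟩, ⟨k, fun _ => hk⟩⟩ ∈
      (bigRep (p := p) κ ρ).toTopRep.ρ.invariants := by
  intro g
  ext x
  change bigRep κ ρ g (BigRepModule.mk (fun _ : ℤ_[p] => a) _) x = a
  rw [bigRep_apply_apply, BigRepModule.mk_apply, ha]

end Invariants

/-! ### §3 The inertia form: `M|_H` trivial when `κ ∘ φ = 1` and `ρ ∘ φ` trivial -/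

section Inertia

variable [TopologicalSpace 𝒪] [TopologicalSpace A] [DiscreteTopology A]
  {G : Type*} [Group G] [TopologicalSpace G] [ContinuousMul G]
  {H : Type*} [Group H] [TopologicalSpace H] [TopologicalSpace (PowerSeries 𝒪)]

/-- **`M|_H` is the trivial representation** along `φ : H → G` when `κ` kills `φ(H)` and `ρ(φ h)`
acts trivially on `A` — the inertia group `I_w ⊂ Γ_K` at a finite `w ∤ p` outside the ramification
of `T` (the `ℤ_p`-extension `κ` is unramified outside `p`): `(h·Φ)(x) = ρ(φ h)(Φ(x − κ(φ h))) = Φ(x)`.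
[cite: Skinner2016PacificMC, §2.3, Lemma 2.3.1 and its proof (p. 180: the inertia invariants of 𝓜)] -/
theorem bigRep_restrict_apply_eq_self (κ : G →ₜ* Multiplicative ℤ_[p]) (ρ : ContinuousRep G 𝒪 A)
    (φ : H →ₜ* G) (hκ : ∀ h : H, κ (φ h) = 1) (hρ : ∀ (h : H) (a : A), ρ (φ h) a = a) (h : H)
    (Φ : BigRepModule 𝒪 p A) : (bigRep (p := p) κ ρ).restrict φ h Φ = Φ := by
  ext x
  rw [ContinuousRep.restrict_apply, bigRep_apply_apply, hκ h, toAdd_one, sub_zero, hρ]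

variable [ContinuousSMul (PowerSeries 𝒪) (BigRepModule 𝒪 p A)]

/-- Along such a `φ` every element is invariant: `(M|_H)^H = ⊤`. [cite: Skinner2016PacificMC, §2.3, Lemma 2.3.1 and its proof (p. 180)] -/
theorem bigRep_restrict_invariants_eq_top (κ : G →ₜ* Multiplicative ℤ_[p])
    (ρ : ContinuousRep G 𝒪 A) (φ : H →ₜ* G) (hκ : ∀ h : H, κ (φ h) = 1)
    (hρ : ∀ (h : H) (a : A), ρ (φ h) a = a) :
    ((bigRep (p := p) κ ρ).restrict φ).toTopRep.ρ.invariants = ⊤ :=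
  eq_top_iff.2 fun Φ _ h => bigRep_restrict_apply_eq_self κ ρ φ hκ hρ h Φ

end Inertia

/-! ### §4 Packaging in the literal hypothesis shapes of `XAc.map_charIdeal_le_span_of_roadFF_unr_le` -/

section Packaging

variable [TopologicalSpace 𝒪] [TopologicalSpace A] [DiscreteTopology A]
  {G : Type*} [Group G] [TopologicalSpace G] [ContinuousMul G] [TopologicalSpace (PowerSeries 𝒪)]
  [ContinuousSMul (PowerSeries 𝒪) (BigRepModule 𝒪 p A)]

/-- **`hglob` discharged**: `p^m`-divisible global invariants of `M = bigRep κ ρ` (they VANISH) from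
"no nonzero `G`-fixed `p`-power torsion in `A`" (`G = Γ_K`: `E(K)[p] = 0`).
[cite: Castella2018Erratum, Lemma 2.1, proof (p. 2: "H⁰(K, M_g) = H⁰(K_∞, A_g) = 0")] -/
theorem divisibleInvariants_bigRep (κ : G →ₜ* Multiplicative ℤ_[p]) (ρ : ContinuousRep G 𝒪 A)
    (hA : ∀ a : A, (∀ g : G, ρ g a = a) → (∃ k : ℕ, p ^ k • a = 0) → a = 0) :
    ∀ m : ℕ, 1 ≤ m → ∀ w ∈ (bigRep (p := p) κ ρ).toTopRep.ρ.invariants,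
      ∃ w' ∈ (bigRep (p := p) κ ρ).toTopRep.ρ.invariants, (C (p : 𝒪) : PowerSeries 𝒪) ^ m • w' = w := by
  intro m _ w hw
  rw [bigRep_invariants_eq_bot κ ρ hA, Submodule.mem_bot] at hw
  subst hw
  exact ⟨0, Submodule.zero_mem _, smul_zero _⟩

variable {H : Type*} [Group H] [TopologicalSpace H] [ContinuousMul H]

/-- **`hloc` discharged at a DECOMPOSITION-type index**: along `φ : H → G` (`Γ_{K_𝔭} → Γ_K`), the
invariants of `M|_H = bigRep (κ ∘ φ) (ρ ∘ φ)` vanish — hence are `p^m`-divisible — if `A` has no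
nonzero `φ(H)`-fixed `p`-power torsion (`E(K_𝔭)[p] = E(ℚ_p)[p] = 0`, hypothesis (iv)).
[cite: Castella2018Erratum, Lemma 2.1, proof (p. 2: "vanishes when so does H⁰(K_𝔭, A_g[ϖ])")] -/
theorem divisibleInvariants_bigRep_restrict_of_forall_fixed_eq_zero
    (κ : G →ₜ* Multiplicative ℤ_[p]) (ρ : ContinuousRep G 𝒪 A) (φ : H →ₜ* G)
    (hA : ∀ a : A, (∀ h : H, ρ (φ h) a = a) → (∃ k : ℕ, p ^ k • a = 0) → a = 0) :
    ∀ m : ℕ, 1 ≤ m → ∀ w ∈ (((bigRep (p := p) κ ρ).restrict φ).toTopRep).ρ.invariants,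
      ∃ w' ∈ (((bigRep (p := p) κ ρ).restrict φ).toTopRep).ρ.invariants,
        (C (p : 𝒪) : PowerSeries 𝒪) ^ m • w' = w := by
  rw [bigRep_restrict]
  exact divisibleInvariants_bigRep (κ.comp φ) (ρ.restrict φ) fun a ha hk =>
    hA a (fun h => by simpa only [ContinuousRep.restrict_apply] using ha h) hk

omit [ContinuousMul H] in
/-- **`hloc` discharged at an INERTIA-type index**: along `φ : H → G` with `κ ∘ φ = 1` and `ρ ∘ φ`
trivial (`I_w → Γ_K`, `w ∤ p` outside the ramification of `T`), the invariants of `M|_H` are ALL of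
`M` and are `p^m`-divisible because `M` is (§1). [cite: Skinner2016PacificMC, §2.3, Lemma 2.3.1 and its proof (p. 180: "(𝓜⁻)^{I_p} ≅ Hom_cts(𝒪, ℚ_p/ℤ_p) … is p-divisible")] -/
theorem divisibleInvariants_bigRep_restrict_of_trivial
    (κ : G →ₜ* Multiplicative ℤ_[p]) (ρ : ContinuousRep G 𝒪 A) (φ : H →ₜ* G)
    (hκ : ∀ h : H, κ (φ h) = 1) (hρ : ∀ (h : H) (a : A), ρ (φ h) a = a)
    (hdiv : ∀ a : A, (∃ k : ℕ, p ^ k • a = 0) → ∃ b : A, p • b = a) :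
    ∀ m : ℕ, 1 ≤ m → ∀ w ∈ (((bigRep (p := p) κ ρ).restrict φ).toTopRep).ρ.invariants,
      ∃ w' ∈ (((bigRep (p := p) κ ρ).restrict φ).toTopRep).ρ.invariants,
        (C (p : 𝒪) : PowerSeries 𝒪) ^ m • w' = w := by
  intro m _ w _
  obtain ⟨w', hw'⟩ := C_pow_smul_surjective (𝒪 := 𝒪) hdiv m w
  refine ⟨w', ?_, hw'⟩
  rw [bigRep_restrict_invariants_eq_top κ ρ φ hκ hρ]
  exact Submodule.mem_top

variable {ι : Type*} {Γv : ι → Type*} [∀ v, Group (Γv v)] [∀ v, TopologicalSpace (Γv v)]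
  [∀ v, ContinuousMul (Γv v)]

/-- **`hloc` for a FAMILY of local maps** `ψ_v : Γ_v → G` and a constrained set `L₀` each of whose
indices is of decomposition type (no nonzero `ψ_v(Γ_v)`-fixed `p`-power torsion in `A`) or of
inertia type (`κ ∘ ψ_v = 1`, `ρ ∘ ψ_v` trivial) — the shape of the erratum's strict set
`{𝔭} ∪ {I_w : w ∉ Σ, w ∤ p}` (`Sel^Σ_𝔭(K, M) = ker{H¹(G_{K,S}, M) → H¹(K_𝔭, M)}`, `S = Σ ∪ S_p`).
[cite: Castella2018Erratum, §2 and Lemma 2.1 (p. 2)] -/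
theorem divisibleInvariants_bigRep_restrict_of_cases
    (κ : G →ₜ* Multiplicative ℤ_[p]) (ρ : ContinuousRep G 𝒪 A) (ψ : ∀ v, Γv v →ₜ* G) (L₀ : Set ι)
    (hdiv : ∀ a : A, (∃ k : ℕ, p ^ k • a = 0) → ∃ b : A, p • b = a)
    (hL : ∀ v ∈ L₀,
      (∀ a : A, (∀ h : Γv v, ρ (ψ v h) a = a) → (∃ k : ℕ, p ^ k • a = 0) → a = 0) ∨
        ((∀ h : Γv v, κ (ψ v h) = 1) ∧ ∀ (h : Γv v) (a : A), ρ (ψ v h) a = a)) :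
    ∀ m : ℕ, 1 ≤ m → ∀ v ∈ L₀, ∀ w ∈ (((bigRep (p := p) κ ρ).restrict (ψ v)).toTopRep).ρ.invariants,
      ∃ w' ∈ (((bigRep (p := p) κ ρ).restrict (ψ v)).toTopRep).ρ.invariants,
        (C (p : 𝒪) : PowerSeries 𝒪) ^ m • w' = w := by
  intro m hm v hv
  rcases hL v hv with hdec | ⟨hκ, hρ⟩
  · exact divisibleInvariants_bigRep_restrict_of_forall_fixed_eq_zero κ ρ (ψ v) hdec m hm
  · exact divisibleInvariants_bigRep_restrict_of_trivial κ ρ (ψ v) hκ hρ hdiv m hm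

end Packaging

end Summit.BirchSwinnertonDyer.Rank1Residual.X11b.BigRep

end
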